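import Mathlib.Analysis.SpecialFunctions.Pow.Complex
import Mathlib.Analysis.Calculus.Deriv.Mul
import Mathlib.Analysis.Calculus.Deriv.Prod
import Mathlib.Analysis.Complex.Basic
import HarnessLib

/-!
# Three-term (tridiagonal) ladders with a complex coupling: the diagonal gauge

Analysis/ODE proof-support file (theorems only; no definitions, no named facts). A three-term recursion / ladder system
`u_J' = -D_J u_J - i r (a u_{J-1} + ā u_{J+1})` (`J ∈ ℤ`, `a ∈ ℂ ∖ {0}`, `r` real) — the Fourier form of transport by one
Kolmogorov shear layer `sin(2πK·x + φ)ê` acting on a Bloch coset `k₀ + ℤK` (Meshalkin–Sinai 1961: the three-term recursion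
of the Kolmogorov-flow linearisation; here `a = e^{iφ}/(4π|m| i)` carries the phase of the layer) — is conjugated by the
DIAGONAL UNITARY GAUGE `v_J = μ^{-J} u_J`, `μ = i a/|a|` (`|μ| = 1`), into the REAL ANTISYMMETRIC ladder
`v_J' = -D_J v_J - r|a| (v_{J-1} - v_{J+1})` (`gauge_rhs`, `HasDerivAt.gauge_ladder`), norms of all modes being unchanged
(`norm_gauge_zpow_mul`). Finitely supported ladders are then packaged as maps into `ι → ℂ` over the finite support with
the tridiagonal matrix `S_{J,J-1} = 1`, `S_{J,J+1} = -1` (`hasDerivAt_pi_ladder`), the form consumed by Lyapunov-functional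
estimates for `v' = -Λ(D + g S)v`.

## References

* L. D. Meshalkin, Ia. G. Sinai, J. Appl. Math. Mech. 25 (1961) 1700–1705 (three-term recursion for the Kolmogorov
  flow). [`MeshalkinSinai1961`]
-/

open Complex Finset
open scoped ComplexConjugate

noncomputable section

namespace Literature.Analysis.ODE

namespace ThreeTermLadder

variable {a : ℂ}

/-- The gauge unit `μ = i a/|a|` is non-zero for `a ≠ 0`. [cite: MeshalkinSinai1961, pp. 1700–1705] -/
theorem gaugeUnit_ne_zero (ha : a ≠ 0) : I * a / (‖a‖ : ℂ) ≠ 0 := by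
  have h1 : (‖a‖ : ℂ) ≠ 0 := by exact_mod_cast (norm_ne_zero_iff.2 ha)
  exact div_ne_zero (mul_ne_zero I_ne_zero ha) h1

/-- The gauge unit has modulus one. [cite: MeshalkinSinai1961, pp. 1700–1705] -/
theorem norm_gaugeUnit (ha : a ≠ 0) : ‖I * a / (‖a‖ : ℂ)‖ = 1 := by
  have h1 : ‖a‖ ≠ 0 := norm_ne_zero_iff.2 ha
  rw [norm_div, norm_mul, Complex.norm_I, one_mul, Complex.norm_real, Real.norm_eq_abs, abs_of_nonneg (norm_nonneg _),
    div_self h1]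

/-- Powers of the gauge unit have modulus one. [cite: MeshalkinSinai1961, pp. 1700–1705] -/
theorem norm_gaugeUnit_zpow (ha : a ≠ 0) (J : ℤ) : ‖(I * a / (‖a‖ : ℂ)) ^ J‖ = 1 := by
  rw [norm_zpow, norm_gaugeUnit ha, one_zpow]

/-- **The gauge preserves the modulus of every mode**: `‖μ^{-J} z‖ = ‖z‖`. [cite: MeshalkinSinai1961, pp. 1700–1705] -/
theorem norm_gauge_zpow_mul (ha : a ≠ 0) (J : ℤ) (z : ℂ) : ‖(I * a / (‖a‖ : ℂ)) ^ (-J) * z‖ = ‖z‖ := by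
  rw [norm_mul, norm_gaugeUnit_zpow ha, one_mul]

/-- First gauge identity: `μ^{-J} (i a) = |a| μ^{-(J-1)}`. [cite: MeshalkinSinai1961, pp. 1700–1705] -/
theorem gauge_zpow_mul_I_mul (ha : a ≠ 0) (J : ℤ) :
    (I * a / (‖a‖ : ℂ)) ^ (-J) * (I * a) = (‖a‖ : ℂ) * (I * a / (‖a‖ : ℂ)) ^ (-(J - 1)) := by
  have hμ := gaugeUnit_ne_zero ha
  have h1 : (‖a‖ : ℂ) ≠ 0 := by exact_mod_cast (norm_ne_zero_iff.2 ha)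
  have e1 : -(J - 1) = -J + 1 := by ring
  rw [e1, zpow_add₀ hμ, zpow_one]
  field_simp

/-- Second gauge identity: `μ^{-J} (i ā) = -|a| μ^{-(J+1)}`. [cite: MeshalkinSinai1961, pp. 1700–1705] -/
theorem gauge_zpow_mul_I_mul_conj (ha : a ≠ 0) (J : ℤ) :
    (I * a / (‖a‖ : ℂ)) ^ (-J) * (I * conj a) = -(‖a‖ : ℂ) * (I * a / (‖a‖ : ℂ)) ^ (-(J + 1)) := by
  have hμ := gaugeUnit_ne_zero ha
  have haa : a * conj a = ((‖a‖ : ℂ)) ^ 2 := by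
    rw [Complex.mul_conj, Complex.normSq_eq_norm_sq]; push_cast; ring
  have key : I * conj a = -(‖a‖ : ℂ) * (I * a / (‖a‖ : ℂ))⁻¹ := by
    rw [inv_div, ← mul_div_assoc, eq_div_iff (mul_ne_zero I_ne_zero ha)]
    calc I * conj a * (I * a) = (I * I) * (a * conj a) := by ring
      _ = -(‖a‖ : ℂ) * (‖a‖ : ℂ) := by rw [Complex.I_mul_I, haa]; ring
  have e1 : -(J + 1) = -J + (-1) := by ring
  rw [e1, zpow_add₀ hμ, zpow_neg_one, key]
  ring

/-- **The gauge identity for the right-hand side of the ladder**: with `μ = i a/|a|`,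
`μ^{-J} (-D u_J - (r i)(a u_{J-1} + ā u_{J+1})) = -D (μ^{-J} u_J) - (r|a|) (μ^{-(J-1)} u_{J-1} - μ^{-(J+1)} u_{J+1})`. [cite: MeshalkinSinai1961, pp. 1700–1705] -/
theorem gauge_rhs (ha : a ≠ 0) (D r uJ um up : ℂ) (J : ℤ) :
    (I * a / (‖a‖ : ℂ)) ^ (-J) * (-D * uJ - (r * I) * (a * um + conj a * up)) =
      -D * ((I * a / (‖a‖ : ℂ)) ^ (-J) * uJ) -
        (r * (‖a‖ : ℂ)) * ((I * a / (‖a‖ : ℂ)) ^ (-(J - 1)) * um - (I * a / (‖a‖ : ℂ)) ^ (-(J + 1)) * up) := by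
  have h1 := gauge_zpow_mul_I_mul ha J
  have h2 := gauge_zpow_mul_I_mul_conj ha J
  -- expand and substitute the two identities
  have e : (I * a / (‖a‖ : ℂ)) ^ (-J) * (-D * uJ - (r * I) * (a * um + conj a * up)) =
      -D * ((I * a / (‖a‖ : ℂ)) ^ (-J) * uJ) -
        r * (((I * a / (‖a‖ : ℂ)) ^ (-J) * (I * a)) * um + ((I * a / (‖a‖ : ℂ)) ^ (-J) * (I * conj a)) * up) := by
    ring
  rw [e, h1, h2]
  ring

/-- **The gauged ladder equation** (one mode, at one time): if
`u_J' = -D u_J(t) - (r i)(a u_{J-1}(t) + ā u_{J+1}(t))` at `t`, then `v_J := μ^{-J} u_J` satisfies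
`v_J' = -D v_J(t) - (r|a|)(v_{J-1}(t) - v_{J+1}(t))` at `t`. [cite: MeshalkinSinai1961, pp. 1700–1705] -/
theorem _root_.HasDerivAt.gauge_ladder (ha : a ≠ 0) {u : ℝ → ℤ → ℂ} {t : ℝ} {J : ℤ} {D r : ℂ}
    (h : HasDerivAt (fun s => u s J) (-D * u t J - (r * I) * (a * u t (J - 1) + conj a * u t (J + 1))) t) :
    HasDerivAt (fun s => (I * a / (‖a‖ : ℂ)) ^ (-J) * u s J)
      (-D * ((I * a / (‖a‖ : ℂ)) ^ (-J) * u t J) -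
        (r * (‖a‖ : ℂ)) * ((I * a / (‖a‖ : ℂ)) ^ (-(J - 1)) * u t (J - 1) -
          (I * a / (‖a‖ : ℂ)) ^ (-(J + 1)) * u t (J + 1))) t := by
  have h1 := h.const_mul ((I * a / (‖a‖ : ℂ)) ^ (-J))
  rw [gauge_rhs ha] at h1
  exact h1

/-- The same within a set. [cite: MeshalkinSinai1961, pp. 1700–1705] -/
theorem _root_.HasDerivWithinAt.gauge_ladder (ha : a ≠ 0) {u : ℝ → ℤ → ℂ} {s : Set ℝ} {t : ℝ} {J : ℤ} {D r : ℂ}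
    (h : HasDerivWithinAt (fun τ => u τ J) (-D * u t J - (r * I) * (a * u t (J - 1) + conj a * u t (J + 1))) s t) :
    HasDerivWithinAt (fun τ => (I * a / (‖a‖ : ℂ)) ^ (-J) * u τ J)
      (-D * ((I * a / (‖a‖ : ℂ)) ^ (-J) * u t J) -
        (r * (‖a‖ : ℂ)) * ((I * a / (‖a‖ : ℂ)) ^ (-(J - 1)) * u t (J - 1) -
          (I * a / (‖a‖ : ℂ)) ^ (-(J + 1)) * u t (J + 1))) s t := by
  have h1 := h.const_mul ((I * a / (‖a‖ : ℂ)) ^ (-J))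
  rw [gauge_rhs ha] at h1
  exact h1

/-! ## Packaging a finitely supported ladder as a map into `ι → ℂ` with a tridiagonal matrix -/

/-- The tridiagonal coupling on a finite set of integers: `S J K = 1` if `K = J - 1`, `-1` if `K = J + 1`, else `0`;
its action on a sequence vanishing off the set is `v(J-1) - v(J+1)`. [cite: MeshalkinSinai1961, pp. 1700–1705] -/
theorem sum_tridiag_apply (Jset : Finset ℤ) {v : ℤ → ℂ} (hv : ∀ K, K ∉ Jset → v K = 0) (J : ℤ) :
    ∑ K : ↥Jset, ((if (K : ℤ) = J - 1 then (1 : ℂ) else 0) + (if (K : ℤ) = J + 1 then -1 else 0)) * v K =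
      v (J - 1) - v (J + 1) := by
  classical
  have hJJ : J - 1 ≠ J + 1 := by omega
  rw [show (∑ K : ↥Jset, ((if (K : ℤ) = J - 1 then (1 : ℂ) else 0) + (if (K : ℤ) = J + 1 then -1 else 0)) * v K) =
      ∑ K ∈ Jset, ((if K = J - 1 then (1 : ℂ) else 0) + (if K = J + 1 then -1 else 0)) * v K from
    (Finset.sum_coe_sort Jset (fun K => ((if K = J - 1 then (1 : ℂ) else 0) + (if K = J + 1 then -1 else 0)) * v K))]
  simp_rw [add_mul, Finset.sum_add_distrib, ite_mul, zero_mul]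
  rw [Finset.sum_ite_eq' Jset (J - 1), Finset.sum_ite_eq' Jset (J + 1)]
  have e1 : (if J - 1 ∈ Jset then (1 : ℂ) * v (J - 1) else 0) = v (J - 1) := by
    split_ifs with h
    · rw [one_mul]
    · rw [hv _ h]
  have e2 : (if J + 1 ∈ Jset then (-1 : ℂ) * v (J + 1) else 0) = -v (J + 1) := by
    split_ifs with h
    · rw [neg_one_mul]
    · rw [hv _ h, neg_zero]
  rw [e1, e2]
  ring

/-- The tridiagonal coupling is real antisymmetric, hence skew-Hermitian. [cite: MeshalkinSinai1961, pp. 1700–1705] -/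
theorem tridiag_skewHermitian (Jset : Finset ℤ) (J K : ↥Jset) :
    ((if ((J : ↥Jset) : ℤ) = (K : ℤ) - 1 then (1 : ℂ) else 0) + (if ((J : ↥Jset) : ℤ) = (K : ℤ) + 1 then -1 else 0)) =
      -conj (((if (K : ℤ) = (J : ℤ) - 1 then (1 : ℂ) else 0) + (if (K : ℤ) = (J : ℤ) + 1 then -1 else 0))) := by
  by_cases h1 : (J : ℤ) = (K : ℤ) - 1
  · have h2 : (K : ℤ) = (J : ℤ) + 1 := by omega
    have h3 : ¬ (J : ℤ) = (K : ℤ) + 1 := by omega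
    have h4 : ¬ (K : ℤ) = (J : ℤ) - 1 := by omega
    rw [if_pos h1, if_neg h3, if_neg h4, if_pos h2]
    simp
  · by_cases h3 : (J : ℤ) = (K : ℤ) + 1
    · have h4 : (K : ℤ) = (J : ℤ) - 1 := by omega
      have h2 : ¬ (K : ℤ) = (J : ℤ) + 1 := by omega
      rw [if_neg h1, if_pos h3, if_pos h4, if_neg h2]
      simp
    · have h2 : ¬ (K : ℤ) = (J : ℤ) + 1 := by omega
      have h4 : ¬ (K : ℤ) = (J : ℤ) - 1 := by omega
      rw [if_neg h1, if_neg h3, if_neg h4, if_neg h2]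
      simp

/-- The tridiagonal coupling has zero diagonal. [cite: MeshalkinSinai1961, pp. 1700–1705] -/
theorem tridiag_diag (Jset : Finset ℤ) (J : ↥Jset) :
    ((if (J : ℤ) = (J : ℤ) - 1 then (1 : ℂ) else 0) + (if (J : ℤ) = (J : ℤ) + 1 then -1 else 0)) = 0 := by
  have h1 : ¬ (J : ℤ) = (J : ℤ) - 1 := by omega
  have h2 : ¬ (J : ℤ) = (J : ℤ) + 1 := by omega
  simp [h1, h2]

/-- **Packaging**: a finitely supported sequence-valued curve `v : ℝ → ℤ → ℂ` whose modes in `Jset` satisfy the real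
antisymmetric ladder `v_J' = -Λ (d_J v_J + g (v_{J-1} - v_{J+1}))` at `t`, and which vanishes off `Jset` at `t`, satisfies,
as a curve in `↥Jset → ℂ`, `V' = (J ↦ -Λ (d_J V_J + g ∑_K S_{JK} V_K))` at `t` with the tridiagonal `S`. [cite: MeshalkinSinai1961, pp. 1700–1705] -/
theorem hasDerivAt_pi_ladder (Jset : Finset ℤ) {v : ℝ → ℤ → ℂ} {t : ℝ} {Λ g : ℂ} {d : ℤ → ℂ}
    (hv : ∀ K, K ∉ Jset → v t K = 0)
    (h : ∀ J ∈ Jset, HasDerivAt (fun s => v s J) (-Λ * (d J * v t J + g * (v t (J - 1) - v t (J + 1)))) t) :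
    HasDerivAt (fun s => fun J : ↥Jset => v s J)
      (fun J : ↥Jset => -Λ * (d J * v t J + g * ∑ K : ↥Jset,
        ((if (K : ℤ) = (J : ℤ) - 1 then (1 : ℂ) else 0) + (if (K : ℤ) = (J : ℤ) + 1 then -1 else 0)) * v t K)) t := by
  rw [hasDerivAt_pi]
  intro J
  rw [sum_tridiag_apply Jset hv]
  exact h J J.2

/-- The same within a set. [cite: MeshalkinSinai1961, pp. 1700–1705] -/
theorem hasDerivWithinAt_pi_ladder (Jset : Finset ℤ) {v : ℝ → ℤ → ℂ} {s : Set ℝ} {t : ℝ} {Λ g : ℂ} {d : ℤ → ℂ}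
    (hv : ∀ K, K ∉ Jset → v t K = 0)
    (h : ∀ J ∈ Jset, HasDerivWithinAt (fun τ => v τ J) (-Λ * (d J * v t J + g * (v t (J - 1) - v t (J + 1)))) s t) :
    HasDerivWithinAt (fun τ => fun J : ↥Jset => v τ J)
      (fun J : ↥Jset => -Λ * (d J * v t J + g * ∑ K : ↥Jset,
        ((if (K : ℤ) = (J : ℤ) - 1 then (1 : ℂ) else 0) + (if (K : ℤ) = (J : ℤ) + 1 then -1 else 0)) * v t K)) s t := by
  rw [hasDerivWithinAt_pi]
  intro J
  rw [sum_tridiag_apply Jset hv]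
  exact h J J.2

/-- The energy of the packaged state is the energy of the modes in `Jset`. [cite: MeshalkinSinai1961, pp. 1700–1705] -/
theorem sum_norm_sq_pi (Jset : Finset ℤ) (v : ℤ → ℂ) :
    ∑ J : ↥Jset, ‖v J‖ ^ 2 = ∑ J ∈ Jset, ‖v J‖ ^ 2 :=
  Finset.sum_coe_sort Jset (fun J => ‖v J‖ ^ 2)

end ThreeTermLadder

end Literature.Analysis.ODE
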